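import Summits.HodgeConjecture.HodgeConjecture.Theorems.K2E1bUnitaryDualOfParts
import Literature.RepresentationTheory.Kovacevic2021.SU21SubmoduleLattice
import HarnessLib

/-!
# K2 ∕ E1b unit U8 — 8b-α′ «AN IRREDUCIBLE RECORD HAS AN IRREDUCIBLE DATUM» (`recordIrreducible : RecordIrreducibleStmt`)

Cell hodgecm-mathlib, Track B «K2-LIT», engine E1b, unit U8 «archimedean packet signs»; crux item h413 = stmt-HodgeConjecture-24833
(supports-only helper; closes nothing by itself).  DEAL (a) of K2E1b-plan (g3) 2026-09-04T03:24:25Z to K2-defs1 (g3): pay the named input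
★ `RecordIrreducibleStmt` (8b-α′, `Theorems/K2E1bUnitaryDualOfParts.lean`, Q12 v3) BY A THEOREM OF EXACTLY THAT TYPE:
`∀ (𝒟 : SU21Datum) (e : ℤ), IsGKModule G21 (ρKOfRecord 𝒟 e) (σOfRecord 𝒟 e) → IsIrreducibleGK (ρKOfRecord 𝒟 e) (σOfRecord 𝒟 e) →
LieModule.IsIrreducible ℂ (Matrix (Fin 3) (Fin 3) ℂ) 𝒟.V`.  THEOREMS ONLY — no definition, no `sorry`, no axiom, no instance (one
`attribute [local instance] LieRing.ofAssociativeRing`), no notation.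

## The proof

A `𝔤𝔩₃(ℂ)`-Lie submodule `N` of a Kovačević datum is the space of finitely supported functions on the labels of the `K`-types it meets
(★ `Kovacevic2021.SU21Datum.toSubmodule_eq_supported`: `K`-types have multiplicity one and a Lie submodule is a sum of WHOLE `K`-types).  Hence
`N` is stable under the twisted `K`-action of record ★ `ρKOfRecord 𝒟 e = kTypeRepTw 𝒟.S e`, which preserves every `K`-type
(★ `kTypeRepTw_kvec_mem_span`), and under ★ `σOfRecord 𝒟 e X = ρ(X̃) + (e∕3)·tr(X)·1` (★ `σOfRecord_isTwistOf`) — i.e. `N` is a `(𝔤, K)`-submodule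
(`isGKSubmodule_toSubmodule_ofRecord`); `(𝔤, K)`-irreducibility (★ `IsIrreducibleGK`) then leaves `N = ⊥` or `N = ⊤`, and `Nontrivial 𝒟.V`
(★ `IsIrreducibleGK.nontrivial`) makes the lattice of Lie submodules simple (`LieModule.IsIrreducible.mk`).  The `IsGKModule` hypothesis of the socket is
carried unused (as in ★ `K2E1bTwistIrreducible.TwistIrreducible`).

Sources: [Kovacevic2021] D. Kovačević, Acta Math. Spalatensia 1 (2021) 105–125, §3 Thm 1–2, Remark 2 (multiplicity-one `K`-types; the submodule
lattice); [BorelWallach2000] 0 §2.5 (`(𝔤, K)`-modules); [KnappVogan1995] §II.4 (after Cor. 2.78).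

HONEST LABEL: HC_CM is proved only modulo the 7 printed citations (2 remaining named inputs: hLiu418 = stmt-HodgeConjecture-24832,
h413 = stmt-HodgeConjecture-24833) until rung 0 closes; paying 8b-α′ closes one OPEN socket of U8d's cone, not h413.
-/

set_option autoImplicit false
set_option linter.dupNamespace false

noncomputable section

namespace Summit.HodgeConjecture.HodgeConjecture.Cruxes.H413.K2E1bGKCohomologyU21.U8

open Literature.NumberTheory.Automorphic
open Literature.RepresentationTheory
open Literature.RepresentationTheory.Kovacevic2021 Literature.RepresentationTheory.Kovacevic2021.SU21Datum
open Summit.HodgeConjecture.HodgeConjecture.Cruxes.H413.F0P3bLocalAPacketsDefs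
open Summit.HodgeConjecture.HodgeConjecture.Cruxes.H413.F0P3bU21Restriction
open Summit.HodgeConjecture.HodgeConjecture.Cruxes.H413.F0P3bKTypeIntegration
open Summit.HodgeConjecture.HodgeConjecture.Cruxes.H413.K2E1bKTypeTwistGK (kTypeRepTw kTypeRepTw_kvec_mem_span)
open Summit.HodgeConjecture.HodgeConjecture.Cruxes.H413.K2E1bCarriersOfRecord

-- Mathlib idiom (as in `GKModules`, the `Upq*` files, the Kovačević topic): commutator bracket on `Module.End` ∕ matrices
attribute [local instance 100] LieRing.ofAssociativeRing

section Record

variable (𝒟 : SU21Datum) (e : ℤ)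

/-- **The twisted `K`-action of record preserves every `K`-type** `V_{n,m} = span_l u^l_{n,m}` (★ `kTypeRepTw_kvec_mem_span`, read on `𝒟.vec`:
`kvec 𝒟.S = 𝒟.vec` by `rfl`). [cite: BorelWallach2000, 0 §2.5] [cite: Kovacevic2021, §3 Def 1] -/
theorem ρKOfRecord_vec_mem_span (g : G21.maximalCompact) (n m k : ℤ) :
    ρKOfRecord 𝒟 e g (𝒟.vec n m k) ∈ Submodule.span ℂ (Set.range fun l : ℤ => 𝒟.vec n m l) :=
  kTypeRepTw_kvec_mem_span (S := 𝒟.S) (e := e) g n m k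

/-- **A `𝔤𝔩₃`-Lie submodule of a datum is a `(𝔤, K)`-submodule of its structure of record** `(ρKOfRecord 𝒟 e, σOfRecord 𝒟 e)`: it is the space of
functions supported on the labels of the `K`-types it meets (★ `toSubmodule_eq_supported`), hence stable under the `K`-type-preserving `K`-action, and
`σOfRecord 𝒟 e X = ⁅X̃, ·⁆ + (e∕3)tr(X)·1` preserves it trivially. [cite: Kovacevic2021, §3 Thm 2, Remark 2] [cite: BorelWallach2000, 0 §2.5] -/
theorem isGKSubmodule_toSubmodule_ofRecord (N : LieSubmodule ℂ (Matrix (Fin 3) (Fin 3) ℂ) 𝒟.V) :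
    IsGKSubmodule (ρKOfRecord 𝒟 e) (σOfRecord 𝒟 e) (N : Submodule ℂ 𝒟.V) := by
  refine ⟨fun g w hw => ?_, fun X w hw => ?_⟩
  · -- `K`-stability: `N = supported T`, `T` a union of whole `K`-types
    set T : Set 𝒟.Idx := {t : 𝒟.Idx | 𝒟.vec t.1.1 t.1.2.1 1 ∈ N} with hT
    have hN : (N : Submodule ℂ 𝒟.V) = Finsupp.supported ℂ ℂ T := toSubmodule_eq_supported N
    have hstab : Submodule.map (ρKOfRecord 𝒟 e g) (Finsupp.supported ℂ ℂ T) ≤ Finsupp.supported ℂ ℂ T := by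
      rw [Finsupp.supported_eq_span_single, Submodule.map_span_le]
      rintro _ ⟨t, ht, rfl⟩
      rw [← Finsupp.supported_eq_span_single]
      obtain ⟨⟨n, m, k⟩, h⟩ := t
      have hv : Finsupp.single (⟨(n, m, k), h⟩ : 𝒟.Idx) (1 : ℂ) = 𝒟.vec n m k := (vec_of_pos n m k h).symm
      dsimp only
      rw [hv]
      refine (Submodule.span_le.2 ?_) (ρKOfRecord_vec_mem_span 𝒟 e g n m k)
      rintro _ ⟨l, rfl⟩
      dsimp only
      by_cases hl : (n, m) ∈ 𝒟.S ∧ 1 ≤ l ∧ l ≤ n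
      · rw [vec_of_pos n m l hl, SetLike.mem_coe]
        exact Finsupp.single_mem_supported ℂ 1 (show (⟨(n, m, l), hl⟩ : 𝒟.Idx) ∈ T from ht)
      · rw [vec_of_neg n m l hl, SetLike.mem_coe]
        exact Submodule.zero_mem _
    rw [LieSubmodule.mem_toSubmodule] at hw
    have hw' : w ∈ (N : Submodule ℂ 𝒟.V) := hw
    rw [hN] at hw' ⊢
    exact hstab ⟨w, hw', rfl⟩
  · -- `𝔤`-stability: `σ X w = ⁅X̃, w⁆ + (e/3) tr(X) • w`
    rw [σOfRecord_isTwistOf 𝒟 e X, LinearMap.add_apply, LinearMap.smul_apply, Module.End.one_apply, kovLie_apply, ρ_apply, ← lie_def]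
    exact (N : Submodule ℂ 𝒟.V).add_mem (N.lie_mem hw) ((N : Submodule ℂ 𝒟.V).smul_mem _ hw)

/-- **8b-α′ PAID: `recordIrreducible : RecordIrreducibleStmt`** — if the structure of record `(ρKOfRecord 𝒟 e, σOfRecord 𝒟 e)` of a Kovačević datum is an
irreducible `(𝔤, K)`-module then `𝒟.V` is an irreducible `𝔤𝔩₃(ℂ)`-Lie module (every Lie submodule is a `(𝔤, K)`-submodule, hence `⊥` or `⊤`; `Nontrivial` from
★ `IsIrreducibleGK.nontrivial`).  The `IsGKModule` binder of the statement is carried unused. [cite: Kovacevic2021, §3 Thm 2, Remark 2] [cite: KnappVogan1995, §II.4] -/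
theorem recordIrreducible : RecordIrreducibleStmt := by
  intro 𝒟 e _ hirr
  haveI : Nontrivial 𝒟.V := hirr.nontrivial
  refine LieModule.IsIrreducible.mk fun N hN => ?_
  rcases hirr.2 (N : Submodule ℂ 𝒟.V) (isGKSubmodule_toSubmodule_ofRecord 𝒟 e N) with h | h
  · exact absurd ((LieSubmodule.toSubmodule_eq_bot N).mp h) hN
  · exact (LieSubmodule.toSubmodule_eq_top N).mp h

/-- Pointwise restatement (the shape most consumers hold). [cite: Kovacevic2021, §3 Thm 2, Remark 2] -/
theorem lieModule_isIrreducible_of_isIrreducibleGK_ofRecord (hirr : IsIrreducibleGK (ρKOfRecord 𝒟 e) (σOfRecord 𝒟 e)) :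
    LieModule.IsIrreducible ℂ (Matrix (Fin 3) (Fin 3) ℂ) 𝒟.V := by
  haveI : Nontrivial 𝒟.V := hirr.nontrivial
  refine LieModule.IsIrreducible.mk fun N hN => ?_
  rcases hirr.2 (N : Submodule ℂ 𝒟.V) (isGKSubmodule_toSubmodule_ofRecord 𝒟 e N) with h | h
  · exact absurd ((LieSubmodule.toSubmodule_eq_bot N).mp h) hN
  · exact (LieSubmodule.toSubmodule_eq_top N).mp h

end Record

end Summit.HodgeConjecture.HodgeConjecture.Cruxes.H413.K2E1bGKCohomologyU21.U8

end
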